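import Mathlib
import HarnessLib
import Summits.ValiantsHypothesis.ValiantsHypothesis.Theorems.MonotoneRestorationOrbitRestorationLinearVolumeQPVHStrength
import Summits.ValiantsHypothesis.ValiantsHypothesis.Theorems.MonotoneRestorationOrbitRestorationLinearVolumeQPHomPolyVNP

/-!
# R1 (`OrbitRestorationLinearVolumeQP`, stmt-ValiantsHypothesis-18294) is VH-strength over any
# polylog-separating linear-volume pattern family — the `VNP` input discharged

Route MonotoneRestoration, aside R1.  `…LinearVolumeQPVHStrength.lean` proved
`R1 → VP ≠ VNP` for every linear-volume pattern family whose homomorphism polynomials (i) form a `VNP` family and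
(ii) are polylog-separating on `0/1` adjacency matrices.  Input (i) is now a theorem of the tree
(`HomPolyVNP.isVNPFamily_homPoly`: hom polynomials of polynomial-size patterns are p-definable), so only the
combinatorial input (ii) remains explicit:

* `valiantsHypothesis_of_orbitRestorationLinearVolumeQP_of_separating` — for bipartite patterns
  `F_n = (Fin (a n) ⊔ Fin (b n), E n)` with `a n + b n ≤ c (n+1)` and `|E n| ≤ (n+2)^c` whose hom polynomials are
  polylog-separating (beyond every order two `≡^{C^{(log₂ m + c')^{c'}}}`-equivalent graphs on `Fin m` with
  different `hom(F_m, ·)`; in print for 2-subdivided bounded-degree expanders via the CFI graphs over them —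
  treewidth-`k` homomorphism-distinguishing closedness, Neuen 2024 / Roberson 2022, as cited in
  Dwivedi–Pago–Seppelt 2026 p. 10 — not formalised here), `OrbitRestorationLinearVolumeQP → ValiantsHypothesis`.

Honest framing: conditional on ONE explicit combinatorial input; shows that the route's "VH-free positive
re-target" R1 is VH-strength over a printed theorem; proves nothing about R1, the crux or VP ≠ VNP.
-/

noncomputable section

-- `Summit.ValiantsHypothesis.ValiantsHypothesis.…` is the tree's single-conjunct layout (Sub = Summit).
set_option linter.dupNamespace false

namespace Summit.ValiantsHypothesis.ValiantsHypothesis.Theorems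

namespace OrbitRestorationLinearVolumeQPVHStrength

open Summit.ValiantsHypothesis.ValiantsHypothesis.Theses.MonotoneRestoration
open Literature.Computability.AlgebraicComplexity
open Literature.ModelTheory.FiniteModelTheory

/-- **R1 ⇒ VP ≠ VNP over any polylog-separating linear-volume pattern family.**  Let
`F_n = (Fin (a n) ⊔ Fin (b n), E n)` be bipartite multigraph patterns with `a n + b n ≤ c (n+1)` vertices and
`|E n| ≤ (n+2)^c` edges whose homomorphism polynomials are polylog-separating on `0/1` adjacency matrices.  Then
`OrbitRestorationLinearVolumeQP` implies Valiant's hypothesis over `ℂ`.  (The hom family is a `VNP` family by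
`HomPolyVNP.isVNPFamily_homPoly`; under `VP = VNP` it is a `VP` family of R1's class with one pattern per level,
and the orbit-form Dawar–Wilsenach pipeline forbids the quasi-polynomial-orbit symmetric circuits R1 would give.)
[cite: DawarWilsenach2025, Thm 5.1, §6, §7.1; DwivediPagoSeppelt2026, Outlook Q3] -/
theorem valiantsHypothesis_of_orbitRestorationLinearVolumeQP_of_separating
    (a b : ℕ → ℕ) (E : (n : ℕ) → Multiset (Fin (a n) × Fin (b n))) (c : ℕ)
    (hvol : ∀ n, a n + b n ≤ c * (n + 1)) (hE : ∀ n, Multiset.card (E n) ≤ (n + 2) ^ c)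
    (hsep : ∀ c' N : ℕ, ∃ m : ℕ, N ≤ m ∧ ∃ X Y : SimpleGraph (Fin m),
      CkEquiv ((Nat.log 2 m + c') ^ c') X Y ∧
        MvPolynomial.eval (Set.indicator {ij : Fin m × Fin m | X.Adj ij.1 ij.2} 1) (homPoly (E m) m ℂ) ≠
          MvPolynomial.eval (Set.indicator {ij : Fin m × Fin m | Y.Adj ij.1 ij.2} 1)
            (homPoly (E m) m ℂ))
    (hR1 : OrbitRestorationLinearVolumeQP) : ValiantsHypothesis := by
  -- `a n, b n ≤ c (n+1) ≤ (n+2)^(c+1)` and `|E n| ≤ (n+2)^c ≤ (n+2)^(c+1)`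
  have hpow : ∀ n, c * (n + 1) ≤ (n + 2) ^ (c + 1) := fun n => by
    have h1 : c ≤ 2 ^ c := Nat.lt_two_pow_self.le
    have h2 : 2 ^ c ≤ (n + 2) ^ c := Nat.pow_le_pow_left (by omega) _
    calc c * (n + 1) ≤ (n + 2) ^ c * (n + 2) := Nat.mul_le_mul (h1.trans h2) (by omega)
      _ = (n + 2) ^ (c + 1) := by ring
  have ha : ∀ n, a n ≤ (n + 2) ^ (c + 1) := fun n =>
    ((Nat.le_add_right _ _).trans (hvol n)).trans (hpow n)
  have hb : ∀ n, b n ≤ (n + 2) ^ (c + 1) := fun n =>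
    ((Nat.le_add_left _ _).trans (hvol n)).trans (hpow n)
  have hE' : ∀ n, Multiset.card (E n) ≤ (n + 2) ^ (c + 1) := fun n =>
    (hE n).trans (Nat.pow_le_pow_right (by omega) (by omega))
  exact valiantsHypothesis_of_orbitRestorationLinearVolumeQP_of_separatingPattern a b E c hvol
    (HomPolyVNP.isVNPFamily_homPoly ℂ a b E (c + 1) ha hb hE') hsep hR1

end OrbitRestorationLinearVolumeQPVHStrength

end Summit.ValiantsHypothesis.ValiantsHypothesis.Theorems

end
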